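import Mathlib
import HarnessLib
import Summits.KontsevichZagierPeriods.KontsevichZagierPeriods.Theorems.SoloInformedLogRoomCore
import Summits.KontsevichZagierPeriods.KontsevichZagierPeriods.Theorems.SoloInformedLogRoomEndpoint

/-!
# SoloInformed — log-room estimates III: left and right endpoints (LEMMA I programme, file F1c)

Solo programme `solo-KontsevichZagierPeriods-informed`, session s140; continues
`SoloInformedLogRoomEndpoint`.  The two endpoint cases of the ONE-VARIABLE LOG-ROOM LEMMA on a
general measurable integration set `J`:

* `soloInformed_logRoom_leftEndpoint_gen`: weight `log⁺ (u - α₀)⁻¹`, `0 < α₀`, scale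
  `0 < L ≤ min α₀ 1`, `(α₀, α₀ + L) ⊆ J ⊆ (α₀, ∞)`;
* `soloInformed_logRoom_rightEndpoint_gen`: weight `log⁺ (β₀ - u)⁻¹`, `0 < β₀`, scale
  `0 < L ≤ min (β₀/2) 1`, `(β₀ - L, β₀) ⊆ J ⊆ (0, β₀)`.

In both, `∫⁻_J u^r (log⁺ …)^p ≤ C(r,p) (1 + log⁺ L⁻¹)^p ∫⁻_J u^r`.  Method: scale splitting
(`soloInformed_posLog_inv_le_scale`), absorption of `log (L/s)` into `s^{-1/2}` on the block of
length `L` next to the endpoint only, and the dyadic pinching of `u^r` on that block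
(`soloInformed_min_rpow_le`, `soloInformed_rpow_le_two_pow_mul_min`), which compares the block
integral with `∫⁻_J u^r` from below.  References: J.-M. Lion, J.-P. Rolin, Ann. Inst. Fourier 48
(1998) 755–767, §1; G. Comte, J.-M. Lion, J.-P. Rolin, Illinois J. Math. 44 (2000) 884–888, Thm. 3.
-/

noncomputable section

open scoped ENNReal
open MeasureTheory Set Real

namespace Summit.KontsevichZagierPeriods.KontsevichZagierPeriods.Theorems

/-! ### A positive left endpoint: `log⁺ (u - α₀)⁻¹`, general integration set -/

/-- LOG-ROOM AT A POSITIVE LEFT ENDPOINT (general set). For every `r` and `p ≥ 1` there is `C ≥ 1`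
such that for all `0 < α₀`, all scales `0 < L ≤ min α₀ 1` and all measurable `J` with
`(α₀, α₀ + L) ⊆ J ⊆ (α₀, ∞)`:
`∫⁻_J u^r (log⁺ (u-α₀)⁻¹)^p ≤ C (1 + log⁺ L⁻¹)^p ∫⁻_J u^r`. [cite: LionRolin1998, §1] -/
theorem soloInformed_logRoom_leftEndpoint_gen (r : ℝ) {p : ℕ} (hp : 0 < p) :
    ∃ C : ℝ, 1 ≤ C ∧ ∀ (α₀ L : ℝ) (J : Set ℝ), 0 < α₀ → 0 < L → L ≤ α₀ → L ≤ 1 →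
      MeasurableSet J → Ioo α₀ (α₀ + L) ⊆ J → J ⊆ Ioi α₀ →
      ∫⁻ u in J, ENNReal.ofReal (u ^ r * (log⁺ (u - α₀)⁻¹) ^ p) ≤
        ENNReal.ofReal (C * (1 + log⁺ L⁻¹) ^ p) * ∫⁻ u in J, ENNReal.ofReal (u ^ r) := by
  have hp' : (0 : ℝ) < p := by exact_mod_cast hp
  set ε : ℝ := 1 / (2 * p) with hε_def
  have hε : 0 < ε := by positivity
  have hεp : ε * p = 1 / 2 := by rw [hε_def]; field_simp
  set E : ℝ := max 1 (ε⁻¹ ^ p) with hE_def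
  have hE1 : 1 ≤ E := le_max_left _ _
  have hEε : ε⁻¹ ^ p ≤ E := le_max_right _ _
  have hR : (1 : ℝ) ≤ 2 ^ |r| := Real.one_le_rpow (by norm_num) (abs_nonneg r)
  refine ⟨2 ^ (p + 2) * 2 ^ |r| * E, ?_, ?_⟩
  · have : (1 : ℝ) ≤ 2 ^ (p + 2) := one_le_pow₀ (by norm_num)
    exact one_le_mul_of_one_le_of_one_le (one_le_mul_of_one_le_of_one_le this hR) hE1
  intro α₀ L J hα hL hLα hL1 hJ hTJ hJI
  set X : ℝ := 1 + log⁺ L⁻¹ with hX_def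
  have hX1 : 1 ≤ X := by have : 0 ≤ log⁺ L⁻¹ := Real.posLog_nonneg; linarith
  have hX0 : 0 ≤ X := zero_le_one.trans hX1
  set m : ℝ := min (α₀ ^ r) ((2 * α₀) ^ r) with hm_def
  have hm : 0 ≤ m := le_min (Real.rpow_nonneg hα.le r) (Real.rpow_nonneg (by linarith) r)
  set I := ∫⁻ u in J, ENNReal.ofReal (u ^ r) with hI_def
  set A : ℝ := 2 ^ p * X ^ p + 2 ^ p * ε⁻¹ ^ p with hA_def
  set B : ℝ := 2 ^ p * ε⁻¹ ^ p * (2 ^ |r| * m) * L ^ (ε * p) with hB_def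
  have hA : 0 ≤ A := by positivity
  have hB : 0 ≤ B := by positivity
  -- pointwise majorant
  have hpt : ∀ u ∈ J, ENNReal.ofReal (u ^ r * (log⁺ (u - α₀)⁻¹) ^ p) ≤
      ENNReal.ofReal (A * u ^ r) +
        (Ioo α₀ (α₀ + L)).indicator (fun u => ENNReal.ofReal (B * (u - α₀) ^ (-(ε * p)))) u := by
    intro u huJ
    have hαu : α₀ < u := hJI huJ
    have hs : 0 < u - α₀ := by linarith
    have hur0 : 0 ≤ u ^ r := Real.rpow_nonneg (hα.le.trans hαu.le) r
    have hlog : log⁺ (u - α₀)⁻¹ ≤ X + (L / (u - α₀)) ^ ε / ε := by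
      have := soloInformed_posLog_inv_le_scale hL hL1 hs hε
      rw [hX_def]; linarith
    have hpow := soloInformed_posLog_inv_pow_le p hX0 hL.le hs hε hlog
    have hspow : 0 ≤ (u - α₀) ^ (-(ε * p)) := Real.rpow_nonneg hs.le _
    by_cases hsL : u - α₀ < L
    · have huT : u ∈ Ioo α₀ (α₀ + L) := ⟨hαu, by linarith⟩
      rw [indicator_of_mem huT, ← ENNReal.ofReal_add (mul_nonneg hA hur0) (mul_nonneg hB hspow)]
      apply ENNReal.ofReal_le_ofReal
      have hurM : u ^ r ≤ 2 ^ |r| * m :=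
        soloInformed_rpow_le_two_pow_mul_min r hα hαu.le (by linarith)
      calc u ^ r * (log⁺ (u - α₀)⁻¹) ^ p
          ≤ u ^ r * (2 ^ p * X ^ p + 2 ^ p * ε⁻¹ ^ p * L ^ (ε * p) * (u - α₀) ^ (-(ε * p))) :=
            mul_le_mul_of_nonneg_left hpow hur0
        _ = 2 ^ p * X ^ p * u ^ r + 2 ^ p * ε⁻¹ ^ p * L ^ (ε * p) * (u - α₀) ^ (-(ε * p)) * u ^ r := by
            ring
        _ ≤ 2 ^ p * X ^ p * u ^ r + 2 ^ p * ε⁻¹ ^ p * L ^ (ε * p) * (u - α₀) ^ (-(ε * p)) * (2 ^ |r| * m)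
              + 2 ^ p * ε⁻¹ ^ p * u ^ r := by
            have h0 : 0 ≤ 2 ^ p * ε⁻¹ ^ p * u ^ r := by positivity
            have h1 : 2 ^ p * ε⁻¹ ^ p * L ^ (ε * p) * (u - α₀) ^ (-(ε * p)) * u ^ r ≤
                2 ^ p * ε⁻¹ ^ p * L ^ (ε * p) * (u - α₀) ^ (-(ε * p)) * (2 ^ |r| * m) :=
              mul_le_mul_of_nonneg_left hurM (by positivity)
            linarith
        _ = A * u ^ r + B * (u - α₀) ^ (-(ε * p)) := by rw [hA_def, hB_def]; ring
    · have huT : u ∉ Ioo α₀ (α₀ + L) := fun h => hsL (by linarith [h.2])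
      rw [indicator_of_notMem huT, add_zero]
      apply ENNReal.ofReal_le_ofReal
      have hone : L ^ (ε * p) * (u - α₀) ^ (-(ε * p)) ≤ 1 :=
        soloInformed_scale_rpow_mul_le_one hL (not_lt.1 hsL) (by positivity)
      calc u ^ r * (log⁺ (u - α₀)⁻¹) ^ p
          ≤ u ^ r * (2 ^ p * X ^ p + 2 ^ p * ε⁻¹ ^ p * L ^ (ε * p) * (u - α₀) ^ (-(ε * p))) :=
            mul_le_mul_of_nonneg_left hpow hur0
        _ = 2 ^ p * X ^ p * u ^ r + 2 ^ p * ε⁻¹ ^ p * u ^ r * (L ^ (ε * p) * (u - α₀) ^ (-(ε * p))) := by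
            ring
        _ ≤ 2 ^ p * X ^ p * u ^ r + 2 ^ p * ε⁻¹ ^ p * u ^ r * 1 := by
            gcongr
        _ = A * u ^ r := by rw [hA_def]; ring
  -- integration
  have hγ : -1 < -(ε * p) := by rw [hεp]; norm_num
  have hTJ' : Ioo α₀ (α₀ + L) ∩ J = Ioo α₀ (α₀ + L) := inter_eq_left.2 hTJ
  have hvol : volume (Ioo α₀ (α₀ + L)) = ENNReal.ofReal L := by
    rw [Real.volume_Ioo, add_sub_cancel_left]
  have hlow : ENNReal.ofReal m * ENNReal.ofReal L ≤ I := by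
    rw [← hvol]
    exact soloInformed_const_mul_volume_le_setLIntegral hTJ measurableSet_Ioo fun u hu =>
      ENNReal.ofReal_le_ofReal (soloInformed_min_rpow_le r hα hu.1.le (by linarith [hu.2]))
  have hkey : B * (L ^ (-(ε * p) + 1) / (-(ε * p) + 1)) = 2 ^ (p + 1) * ε⁻¹ ^ p * 2 ^ |r| * (m * L) := by
    rw [hB_def, hεp]
    have h1 : (-(1 / 2 : ℝ) + 1) = 1 / 2 := by norm_num
    have h2 : L ^ (1 / 2 : ℝ) * L ^ (1 / 2 : ℝ) = L := by
      rw [← Real.rpow_add hL]; norm_num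
    rw [h1]
    calc 2 ^ p * ε⁻¹ ^ p * (2 ^ |r| * m) * L ^ (1 / 2 : ℝ) * (L ^ (1 / 2 : ℝ) / (1 / 2))
        = 2 ^ (p + 1) * ε⁻¹ ^ p * 2 ^ |r| * (m * (L ^ (1 / 2 : ℝ) * L ^ (1 / 2 : ℝ))) := by ring
      _ = 2 ^ (p + 1) * ε⁻¹ ^ p * 2 ^ |r| * (m * L) := by rw [h2]
  calc ∫⁻ u in J, ENNReal.ofReal (u ^ r * (log⁺ (u - α₀)⁻¹) ^ p)
      ≤ ∫⁻ u in J, (ENNReal.ofReal (A * u ^ r) +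
          (Ioo α₀ (α₀ + L)).indicator (fun u => ENNReal.ofReal (B * (u - α₀) ^ (-(ε * p)))) u) :=
        setLIntegral_mono' hJ hpt
    _ = (∫⁻ u in J, ENNReal.ofReal (A * u ^ r)) +
          ∫⁻ u in J, (Ioo α₀ (α₀ + L)).indicator (fun u => ENNReal.ofReal (B * (u - α₀) ^ (-(ε * p)))) u :=
        lintegral_add_left (soloInformed_measurable_ofReal_const_mul_rpow A r) _
    _ = ENNReal.ofReal A * I + ENNReal.ofReal B * ENNReal.ofReal (L ^ (-(ε * p) + 1) / (-(ε * p) + 1)) := by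
        rw [soloInformed_setLIntegral_ofReal_const_mul hA, soloInformed_setLIntegral_indicator measurableSet_Ioo,
          hTJ', soloInformed_setLIntegral_ofReal_const_mul hB,
          soloInformed_lintegral_rpow_sub_left_endpoint hγ hL.le]
    _ = ENNReal.ofReal A * I + ENNReal.ofReal (2 ^ (p + 1) * ε⁻¹ ^ p * 2 ^ |r|) *
          (ENNReal.ofReal m * ENNReal.ofReal L) := by
        rw [← ENNReal.ofReal_mul hB, hkey, ENNReal.ofReal_mul (p := 2 ^ (p + 1) * ε⁻¹ ^ p * 2 ^ |r|)
          (by positivity), ENNReal.ofReal_mul hm]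
    _ ≤ ENNReal.ofReal A * I + ENNReal.ofReal (2 ^ (p + 1) * ε⁻¹ ^ p * 2 ^ |r|) * I := by
        gcongr
    _ = ENNReal.ofReal (A + 2 ^ (p + 1) * ε⁻¹ ^ p * 2 ^ |r|) * I := by
        rw [← add_mul, ← ENNReal.ofReal_add hA (by positivity)]
    _ ≤ ENNReal.ofReal (2 ^ (p + 2) * 2 ^ |r| * E * X ^ p) * I := by
        gcongr
        rw [hA_def]
        exact soloInformed_logRoom_finalConst p hX1 hE1 hEε hR

/-! ### The right endpoint: `log⁺ (β₀ - u)⁻¹`, general integration set -/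

/-- LOG-ROOM AT THE RIGHT ENDPOINT (general set). For every `r` and `p ≥ 1` there is `C ≥ 1` such
that for all `0 < β₀`, all scales `0 < L ≤ min (β₀/2) 1` and all measurable `J` with
`(β₀ - L, β₀) ⊆ J ⊆ (0, β₀)`:
`∫⁻_J u^r (log⁺ (β₀-u)⁻¹)^p ≤ C (1 + log⁺ L⁻¹)^p ∫⁻_J u^r`. [cite: LionRolin1998, §1] -/
theorem soloInformed_logRoom_rightEndpoint_gen (r : ℝ) {p : ℕ} (hp : 0 < p) :
    ∃ C : ℝ, 1 ≤ C ∧ ∀ (β₀ L : ℝ) (J : Set ℝ), 0 < β₀ → 0 < L → L ≤ β₀ / 2 → L ≤ 1 →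
      MeasurableSet J → Ioo (β₀ - L) β₀ ⊆ J → J ⊆ Ioo 0 β₀ →
      ∫⁻ u in J, ENNReal.ofReal (u ^ r * (log⁺ (β₀ - u)⁻¹) ^ p) ≤
        ENNReal.ofReal (C * (1 + log⁺ L⁻¹) ^ p) * ∫⁻ u in J, ENNReal.ofReal (u ^ r) := by
  have hp' : (0 : ℝ) < p := by exact_mod_cast hp
  set ε : ℝ := 1 / (2 * p) with hε_def
  have hε : 0 < ε := by positivity
  have hεp : ε * p = 1 / 2 := by rw [hε_def]; field_simp
  set E : ℝ := max 1 (ε⁻¹ ^ p) with hE_def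
  have hE1 : 1 ≤ E := le_max_left _ _
  have hEε : ε⁻¹ ^ p ≤ E := le_max_right _ _
  have hR : (1 : ℝ) ≤ 2 ^ |r| := Real.one_le_rpow (by norm_num) (abs_nonneg r)
  refine ⟨2 ^ (p + 2) * 2 ^ |r| * E, ?_, ?_⟩
  · have : (1 : ℝ) ≤ 2 ^ (p + 2) := one_le_pow₀ (by norm_num)
    exact one_le_mul_of_one_le_of_one_le (one_le_mul_of_one_le_of_one_le this hR) hE1
  intro β₀ L J hβ hL hLβ hL1 hJ hTJ hJI
  -- pinching base `b = β₀ / 2`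
  set b : ℝ := β₀ / 2 with hb_def
  have hb : 0 < b := by positivity
  have h2b : 2 * b = β₀ := by rw [hb_def]; ring
  set X : ℝ := 1 + log⁺ L⁻¹ with hX_def
  have hX1 : 1 ≤ X := by have : 0 ≤ log⁺ L⁻¹ := Real.posLog_nonneg; linarith
  have hX0 : 0 ≤ X := zero_le_one.trans hX1
  set m : ℝ := min (b ^ r) ((2 * b) ^ r) with hm_def
  have hm : 0 ≤ m := le_min (Real.rpow_nonneg hb.le r) (Real.rpow_nonneg (by linarith) r)
  set I := ∫⁻ u in J, ENNReal.ofReal (u ^ r) with hI_def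
  set A : ℝ := 2 ^ p * X ^ p + 2 ^ p * ε⁻¹ ^ p with hA_def
  set B : ℝ := 2 ^ p * ε⁻¹ ^ p * (2 ^ |r| * m) * L ^ (ε * p) with hB_def
  have hA : 0 ≤ A := by positivity
  have hB : 0 ≤ B := by positivity
  have hpt : ∀ u ∈ J, ENNReal.ofReal (u ^ r * (log⁺ (β₀ - u)⁻¹) ^ p) ≤
      ENNReal.ofReal (A * u ^ r) +
        (Ioo (β₀ - L) β₀).indicator (fun u => ENNReal.ofReal (B * (β₀ - u) ^ (-(ε * p)))) u := by
    intro u huJ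
    have hu0 : 0 < u := (hJI huJ).1
    have huβ : u < β₀ := (hJI huJ).2
    have hs : 0 < β₀ - u := by linarith
    have hur0 : 0 ≤ u ^ r := Real.rpow_nonneg hu0.le r
    have hlog : log⁺ (β₀ - u)⁻¹ ≤ X + (L / (β₀ - u)) ^ ε / ε := by
      have := soloInformed_posLog_inv_le_scale hL hL1 hs hε
      rw [hX_def]; linarith
    have hpow := soloInformed_posLog_inv_pow_le p hX0 hL.le hs hε hlog
    have hspow : 0 ≤ (β₀ - u) ^ (-(ε * p)) := Real.rpow_nonneg hs.le _
    by_cases hsL : β₀ - u < L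
    · have huT : u ∈ Ioo (β₀ - L) β₀ := ⟨by linarith, huβ⟩
      rw [indicator_of_mem huT, ← ENNReal.ofReal_add (mul_nonneg hA hur0) (mul_nonneg hB hspow)]
      apply ENNReal.ofReal_le_ofReal
      have hurM : u ^ r ≤ 2 ^ |r| * m :=
        soloInformed_rpow_le_two_pow_mul_min r hb (by linarith) (by linarith)
      calc u ^ r * (log⁺ (β₀ - u)⁻¹) ^ p
          ≤ u ^ r * (2 ^ p * X ^ p + 2 ^ p * ε⁻¹ ^ p * L ^ (ε * p) * (β₀ - u) ^ (-(ε * p))) :=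
            mul_le_mul_of_nonneg_left hpow hur0
        _ = 2 ^ p * X ^ p * u ^ r + 2 ^ p * ε⁻¹ ^ p * L ^ (ε * p) * (β₀ - u) ^ (-(ε * p)) * u ^ r := by
            ring
        _ ≤ 2 ^ p * X ^ p * u ^ r + 2 ^ p * ε⁻¹ ^ p * L ^ (ε * p) * (β₀ - u) ^ (-(ε * p)) * (2 ^ |r| * m)
              + 2 ^ p * ε⁻¹ ^ p * u ^ r := by
            have h0 : 0 ≤ 2 ^ p * ε⁻¹ ^ p * u ^ r := by positivity
            have h1 : 2 ^ p * ε⁻¹ ^ p * L ^ (ε * p) * (β₀ - u) ^ (-(ε * p)) * u ^ r ≤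
                2 ^ p * ε⁻¹ ^ p * L ^ (ε * p) * (β₀ - u) ^ (-(ε * p)) * (2 ^ |r| * m) :=
              mul_le_mul_of_nonneg_left hurM (by positivity)
            linarith
        _ = A * u ^ r + B * (β₀ - u) ^ (-(ε * p)) := by rw [hA_def, hB_def]; ring
    · have huT : u ∉ Ioo (β₀ - L) β₀ := fun h => hsL (by linarith [h.1])
      rw [indicator_of_notMem huT, add_zero]
      apply ENNReal.ofReal_le_ofReal
      have hone : L ^ (ε * p) * (β₀ - u) ^ (-(ε * p)) ≤ 1 :=
        soloInformed_scale_rpow_mul_le_one hL (not_lt.1 hsL) (by positivity)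
      calc u ^ r * (log⁺ (β₀ - u)⁻¹) ^ p
          ≤ u ^ r * (2 ^ p * X ^ p + 2 ^ p * ε⁻¹ ^ p * L ^ (ε * p) * (β₀ - u) ^ (-(ε * p))) :=
            mul_le_mul_of_nonneg_left hpow hur0
        _ = 2 ^ p * X ^ p * u ^ r + 2 ^ p * ε⁻¹ ^ p * u ^ r * (L ^ (ε * p) * (β₀ - u) ^ (-(ε * p))) := by
            ring
        _ ≤ 2 ^ p * X ^ p * u ^ r + 2 ^ p * ε⁻¹ ^ p * u ^ r * 1 := by
            gcongr
        _ = A * u ^ r := by rw [hA_def]; ring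
  -- integration
  have hγ : -1 < -(ε * p) := by rw [hεp]; norm_num
  have hTJ' : Ioo (β₀ - L) β₀ ∩ J = Ioo (β₀ - L) β₀ := inter_eq_left.2 hTJ
  have hvol : volume (Ioo (β₀ - L) β₀) = ENNReal.ofReal L := by
    rw [Real.volume_Ioo, sub_sub_cancel]
  have hlow : ENNReal.ofReal m * ENNReal.ofReal L ≤ I := by
    rw [← hvol]
    exact soloInformed_const_mul_volume_le_setLIntegral hTJ measurableSet_Ioo fun u hu =>
      ENNReal.ofReal_le_ofReal (soloInformed_min_rpow_le r hb (by linarith [hu.1]) (by linarith [hu.2]))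
  have hkey : B * (L ^ (-(ε * p) + 1) / (-(ε * p) + 1)) = 2 ^ (p + 1) * ε⁻¹ ^ p * 2 ^ |r| * (m * L) := by
    rw [hB_def, hεp]
    have h1 : (-(1 / 2 : ℝ) + 1) = 1 / 2 := by norm_num
    have h2 : L ^ (1 / 2 : ℝ) * L ^ (1 / 2 : ℝ) = L := by
      rw [← Real.rpow_add hL]; norm_num
    rw [h1]
    calc 2 ^ p * ε⁻¹ ^ p * (2 ^ |r| * m) * L ^ (1 / 2 : ℝ) * (L ^ (1 / 2 : ℝ) / (1 / 2))
        = 2 ^ (p + 1) * ε⁻¹ ^ p * 2 ^ |r| * (m * (L ^ (1 / 2 : ℝ) * L ^ (1 / 2 : ℝ))) := by ring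
      _ = 2 ^ (p + 1) * ε⁻¹ ^ p * 2 ^ |r| * (m * L) := by rw [h2]
  calc ∫⁻ u in J, ENNReal.ofReal (u ^ r * (log⁺ (β₀ - u)⁻¹) ^ p)
      ≤ ∫⁻ u in J, (ENNReal.ofReal (A * u ^ r) +
          (Ioo (β₀ - L) β₀).indicator (fun u => ENNReal.ofReal (B * (β₀ - u) ^ (-(ε * p)))) u) :=
        setLIntegral_mono' hJ hpt
    _ = (∫⁻ u in J, ENNReal.ofReal (A * u ^ r)) +
          ∫⁻ u in J, (Ioo (β₀ - L) β₀).indicator (fun u => ENNReal.ofReal (B * (β₀ - u) ^ (-(ε * p)))) u :=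
        lintegral_add_left (soloInformed_measurable_ofReal_const_mul_rpow A r) _
    _ = ENNReal.ofReal A * I + ENNReal.ofReal B * ENNReal.ofReal (L ^ (-(ε * p) + 1) / (-(ε * p) + 1)) := by
        rw [soloInformed_setLIntegral_ofReal_const_mul hA, soloInformed_setLIntegral_indicator measurableSet_Ioo,
          hTJ', soloInformed_setLIntegral_ofReal_const_mul hB,
          soloInformed_lintegral_rpow_sub_right_endpoint hγ hL.le]
    _ = ENNReal.ofReal A * I + ENNReal.ofReal (2 ^ (p + 1) * ε⁻¹ ^ p * 2 ^ |r|) *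
          (ENNReal.ofReal m * ENNReal.ofReal L) := by
        rw [← ENNReal.ofReal_mul hB, hkey, ENNReal.ofReal_mul (p := 2 ^ (p + 1) * ε⁻¹ ^ p * 2 ^ |r|)
          (by positivity), ENNReal.ofReal_mul hm]
    _ ≤ ENNReal.ofReal A * I + ENNReal.ofReal (2 ^ (p + 1) * ε⁻¹ ^ p * 2 ^ |r|) * I := by
        gcongr
    _ = ENNReal.ofReal (A + 2 ^ (p + 1) * ε⁻¹ ^ p * 2 ^ |r|) * I := by
        rw [← add_mul, ← ENNReal.ofReal_add hA (by positivity)]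
    _ ≤ ENNReal.ofReal (2 ^ (p + 2) * 2 ^ |r| * E * X ^ p) * I := by
        gcongr
        rw [hA_def]
        exact soloInformed_logRoom_finalConst p hX1 hE1 hEε hR

end Summit.KontsevichZagierPeriods.KontsevichZagierPeriods.Theorems
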